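/-
Copyright (c) 2026 the pub-hodgecm-mathlib formalisation cell (harness21).  Prover seat hodgecm-mathlib-K2E3-p06 (g4), Track B «K2-LIT», engine E3, unit U4 «Keys»; deal (D61)
LINE LEAD of the open leaf (U4f-χ₁-ram-one), design D-I v2, plan step Z2A-3c (iii) «THE LETTERS OF THE TYPE VECTOR: datum with `N̄` clause, `hθH`, `hθC`, `hBC`» on `U(Φ₃)(L⁺_v)`;
2026-09-04.  KERNEL module: THEOREMS ONLY (no definition, no named fact, no `sorry`, no instance, no notation).
-/
import Summits.HodgeConjecture.HodgeConjecture.Theorems.K2E3BranchATorusWitnessCM           -- ★-filed Z2A-3c (ii) (this seat): `exists_torusWitness`, `twist_comp_proj_apply_one`; brings ★ letters (i), ★ Z2A-3b, ★ Detection, the frame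
import Summits.HodgeConjecture.HodgeConjecture.Theorems.K2E3BranchAContradiction             -- ★ Z2A-4 p858377 (this seat): `false_of_typeVector_of_integral_eq_zero`
import Summits.HodgeConjecture.HodgeConjecture.Theorems.K2E3TypeVectorOfSubrepFactored        -- ★ V2b p858197 (this seat): `exists_typeVector_of_mem_of_factored`
import Summits.HodgeConjecture.HodgeConjecture.Theorems.K2E3IwahoriDatumDilation              -- ★ Z2A-2 p858273 (this seat): `exists_dilate_typeReady`
import Summits.HodgeConjecture.HodgeConjecture.Theorems.K2E3IntertwiningKernelOfReducible     -- ★ V1 p857640 (this seat): `exists_section_apply_one_ne_zero_forall_intertwiningIntegral_eq_zero`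
import Summits.HodgeConjecture.HodgeConjecture.Theorems.K2E3IwahoriLinePF                     -- ★ (K2E3-p05): brings ★ `K2E3IwahoriLevelDatumPF.exists_iwahoriDatum_iwahoriLevel`, ★ `StructureTransport.exists_iwahoriDatum_comap`
import HarnessLib

/-!
# K2 ∕ E3 «EllipticInputs», unit U4 «Keys» — (U4f-χ₁-ram-one) steps Z2A-3c (iii) + Z2A-5: BRANCH A OF KEYS' THEOREM AT DEPTH ZERO
# «`χ₁` contracting, non-unitary, trivial on principal units, with `χ₁ ∘ N ≠ 1` on `𝒪ˣ` ⟹ `i(χ₁, 1)` is IRREDUCIBLE» on `U(Φ₃)(L⁺_v)`, `v` non-split (inert or ramified, any residue characteristic)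
# [Keys1984 §3, §7 Thm (2); Casselman1995 §6.4; MoyPrasad1996 §3; Roche1998 §3–§4]

Cell hodgecm-mathlib (D-0151), FLOOR 0, Track B «K2-LIT», engine E3, crux item H413 = stmt-HodgeConjecture-24833 (route `HCCMUnconditional`, no route verbs); target BY NAME
the OPEN leaf `…K2E3EllipticInputs.U4Keys.sig_K2E3KeysThmTwoContractingRamifiedCharOne` (U4Keys ED. 7), design D-I v2, plan step Z2A (Branch A), CM assembly.  Author K2E3-p06 (g4),
line lead (D61).  `--supports stmt-HodgeConjecture-24833 --as helper`; THEOREMS ONLY.  NOT THE PAYER (Branch A only, depth zero only; Branch B = Keys (b)–(d) is Z2–Z4).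

THE POINT.  Design D-I «vanishing functional», Branch A, assembled on `G = U(Φ₃)(L⁺_v)` in the (G3)-EXPLICIT frame: suppose `i(χ) = i(χ₁, 1)` reducible.  ★ V1 gives a
`G`-stable `V ∋ f`, `f(1) ≠ 0`, killed by `Λ_{w₀}`; §1 an Iwahori datum `𝓘` with `𝓘.K 0 = I` AND `𝓘.N̄ = eA⁻¹(N̄_w)` (★ p05's transport, clause kept); ★ Z2A-2 makes `f`
fixed by `I ∩ N̄` inside `V`; ★ V2b (letters: `hBC` from `𝓘.factorization 0`, §3; `hθmul` ★ Z2A-3b `theta_mul`; `hθH` §2 (`θ(p) = χ₁(torusEntry 0 (proj p)) = τ(p)·1` on `P ∩ I`,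
`δ^{1∕2} = 1` on the compact `I`); `hθC` §2 (`θ = 1` on `eA⁻¹(N̄_w)`)) yields the `(I, θ)`-TYPE VECTOR `f′ ∈ V`, `f′(1) ≠ 0`; ★ Z2A-4 with the ★ letters (i) (`hw hN hdich hθ`) and
(ii) (`b₀ hb₀H hne`, from `u ∈ 𝒪ˣ` with `χ₁(u σu) ≠ 1`) and `hΛ` from V1 gives `False`.
* §1 `exists_iwahoriDatum_K_zero_eq_Nbar_eq` (p05's ★ `exists_iwahoriDatum_K_zero_eq` with the clause `𝓘.Nbar = eA⁻¹(N.map (conj w))` kept).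
* §2 `theta_eq_one_of_map_mem` (`θ = 1` on `eA⁻¹(N̄_w)`), `theta_eq_tau_of_mem` (letter `hθH`).
* §3 `exists_mem_P_mul_of_mem` (letter `hBC` from the Iwahori factorisation of the datum).
(The assembly `false_of_reducible_of_normChar_ne_one` — ★ V1 → §1 → ★ Z2A-2 → ★ V2b with §2–§3 → ★ Z2A-4 — is the next file `K2E3BranchAIrreducibleDepthZero`.)
HONEST LABEL: HC_CM is proved only modulo the 7 printed citations (2 remaining named inputs: hLiu418 = stmt-HodgeConjecture-24832, h413 = stmt-HodgeConjecture-24833)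
until rung 0 closes; count-neutral — this file does NOT pay the leaf; no printed citation is discharged.

## References
* [Keys1984] D. Keys, Compositio Math. 51 (1984), §3, §7 Thm (2) (reducibility of unitary principal series of `SU(3)`∕`U(3)`: the group `W_χ`).
* [Casselman1995] W. Casselman, *Introduction to the theory of admissible representations of `p`-adic reductive groups* (1995), §6.4.
* [MoyPrasad1996] A. Moy, G. Prasad, Comment. Math. Helv. 71 (1996), §3 (depth-zero types).
* [Roche1998] A. Roche, Ann. Sci. ÉNS (4) 31 (1998), §3–§4.
* [BruhatTits1972] F. Bruhat, J. Tits, Publ. Math. IHÉS 41 (1972), (4.4.4).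
-/

set_option autoImplicit false
-- the mandated namespace has the single-problem summit's repeated segment (`HodgeConjecture.HodgeConjecture`)
set_option linter.dupNamespace false

noncomputable section

open NumberField IsDedekindDomain MeasureTheory ValuativeRel
open scoped Matrix MatrixGroups WithZero Valued
open Literature.NumberTheory Literature.NumberTheory.Automorphic Literature.NumberTheory.Automorphic.UnitaryGroup
open Literature.NumberTheory.Rogawski1990

namespace Summit.HodgeConjecture.HodgeConjecture.Cruxes.H413.K2E3BranchATypeLettersCM

open Summit.HodgeConjecture.HodgeConjecture.Cruxes.H413
open Summit.HodgeConjecture.HodgeConjecture.Cruxes.H413.K2E3DepthZeroIwahoriCharacterCM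
open Summit.HodgeConjecture.HodgeConjecture.Cruxes.H413.K2E3BranchALettersCM
open Summit.HodgeConjecture.HodgeConjecture.Cruxes.H413.K2E3BranchATorusWitnessCM

variable (L : Type) [Field L] [NumberField L] [IsCMField L] (v : HeightOneSpectrum (𝓞 ↥(maximalRealSubfield L)))
  (w : PlacesOver L v) (hw : IsCMField.complexConj L • w.1 = w.1)
  (eA : Gqs L v ≃ₜ* ↥(unitaryGroupOfForm (galAdicCompletionMap (L := L) (IsCMField.complexConj L) hw) ((StdForm.antidiagonal 3).over (w.1.adicCompletion L))))
  (heA : ∀ g : Gqs L v,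
    ((eA g : ↥(unitaryGroupOfForm (galAdicCompletionMap (L := L) (IsCMField.complexConj L) hw) ((StdForm.antidiagonal 3).over (w.1.adicCompletion L)))) :
        GL (Fin 3) (w.1.adicCompletion L)) =
      ((localNonsplitEquiv (IsCMField.complexConj L) (qsForm L) (IsCMField.complexConj_ne_one L) w hw g :
        ↥(unitaryGroupOfForm (galAdicCompletionMap (L := L) (IsCMField.complexConj L) hw) (placeForm (qsForm L) w.1))) : GL (Fin 3) (w.1.adicCompletion L)))
  {ϖ : w.1.adicCompletion L} (hϖ : Valued.v ϖ = WithZero.exp (-1 : ℤ))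
  (g₁ : GL (Fin 3) (w.1.adicCompletion L)) (hg₁ : (g₁ : Matrix (Fin 3) (Fin 3) (w.1.adicCompletion L)) = Matrix.diagonal ![(1 : w.1.adicCompletion L), 1, ϖ])
  (K0 K1 I : Subgroup (Gqs L v))
  (hK0 : K0 = ((glInt 3 (w.1.adicCompletion L)).subgroupOf
    (unitaryGroupOfForm (galAdicCompletionMap (L := L) (IsCMField.complexConj L) hw) ((StdForm.antidiagonal 3).over (w.1.adicCompletion L)))).comap
      eA.toMulEquiv.toMonoidHom)
  (hK1 : K1 = (((glInt 3 (w.1.adicCompletion L)).map (MulAut.conj g₁).toMonoidHom).subgroupOf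
    (unitaryGroupOfForm (galAdicCompletionMap (L := L) (IsCMField.complexConj L) hw) ((StdForm.antidiagonal 3).over (w.1.adicCompletion L)))).comap
      eA.toMulEquiv.toMonoidHom)
  (hI : I = K0 ⊓ K1)

/-! ## §1 An Iwahori datum with `K 0 = I` and `N̄ = eA⁻¹(w N w)` -/

include heA hϖ hg₁ hK0 hK1 hI in
set_option maxHeartbeats 1600000 in
-- the ray data and the transport clauses (class of ★ `K2E3IwahoriLinePF.exists_iwahoriDatum_K_zero_eq`, whose proof this is, with the `Nbar` clause kept)
/-- **An Iwahori datum for `cmBorelTriple L 3 v` with `𝓘.K 0 = I` AND `𝓘.N̄ = eA⁻¹(N_w.map (conj w))`** — ★ `K2E3IwahoriLinePF.exists_iwahoriDatum_K_zero_eq` (model datum ★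
`exists_iwahoriDatum_iwahoriLevel` pulled back by ★ `StructureTransport.exists_iwahoriDatum_comap`) keeping the transport clause for `N̄` that Branch A needs (`θ = 1` on `N̄`).
[cite: Casselman1995, Prop. 1.4.4, Thm. 3.3.3] [cite: BruhatTits1972, (4.4.4)] -/
theorem exists_iwahoriDatum_K_zero_eq_Nbar_eq :
    ∃ 𝓘 : (cmBorelTriple L 3 v).IwahoriDatum, 𝓘.K 0 = I ∧
      𝓘.Nbar = (((borelTriple (galAdicCompletionMap (L := L) (IsCMField.complexConj L) hw) ((StdForm.antidiagonal 3).over (w.1.adicCompletion L)) rfl).N).map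
        (MulAut.conj (weylLongU (galAdicCompletionMap (L := L) (IsCMField.complexConj L) hw)
          (rfl : (StdForm.antidiagonal 3).over (w.1.adicCompletion L) = _))).toMonoidHom).comap
        (eA : Gqs L v →* ↥(unitaryGroupOfForm (galAdicCompletionMap (L := L) (IsCMField.complexConj L) hw) ((StdForm.antidiagonal 3).over (w.1.adicCompletion L)))) := by
  have hσσ := (galAdicCompletionMap_galAdicCompletionMap_of_smul_eq (IsCMField.complexConj L) w (IsCMField.complexConj_ne_one L) hw)
  have hϖ0 : ϖ ≠ 0 := CartanUnique.uniformizer_ne_zero hϖ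
  have hσϖ0 : galAdicCompletionMap (L := L) (IsCMField.complexConj L) hw ϖ ≠ 0 := (map_ne_zero _).2 hϖ0
  -- the ray `s = d(ϖ, 1, (σϖ)⁻¹)` and its ratio data
  obtain ⟨s, -, hs⟩ := exists_coe_eq_diag (galAdicCompletionMap (L := L) (IsCMField.complexConj L) hw)
    (rfl : (StdForm.antidiagonal 3).over (w.1.adicCompletion L) = _) hσσ hϖ0 (β := 1) (by rw [map_one, mul_one])
  have hvσϖ : valuation (w.1.adicCompletion L) (galAdicCompletionMap (L := L) (IsCMField.complexConj L) hw ϖ) = valuation (w.1.adicCompletion L) ϖ :=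
    (v_eq_iff_valuation_eq _ _).1 ((fun a => valued_galAdicCompletionMap (L := L) (IsCMField.complexConj L) hw a) ϖ)
  have hq0 : valuation (w.1.adicCompletion L) ϖ ≠ 0 := (Valuation.ne_zero_iff _).2 hϖ0
  have hq1 : valuation (w.1.adicCompletion L) ϖ < 1 := by
    rw [← v_lt_one_iff_valuation_lt_one, hϖ, ← WithZero.exp_zero, WithZero.exp_lt_exp]; norm_num
  set u : Fin 3 → (w.1.adicCompletion L)ˣ := ![Units.mk0 ϖ hϖ0, 1, (Units.mk0 _ hσϖ0)⁻¹] with hu_def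
  have hu0 : ((u 0 : (w.1.adicCompletion L)ˣ) : w.1.adicCompletion L) = ϖ := by simp only [hu_def, Matrix.cons_val_zero, Units.val_mk0]
  have hu1 : ((u 1 : (w.1.adicCompletion L)ˣ) : w.1.adicCompletion L) = 1 := by simp only [hu_def, Matrix.cons_val_one, Matrix.cons_val_zero, Units.val_one]
  have hu2 : ((u 2 : (w.1.adicCompletion L)ˣ) : w.1.adicCompletion L) = (galAdicCompletionMap (L := L) (IsCMField.complexConj L) hw ϖ)⁻¹ := by
    simp only [hu_def, Matrix.cons_val_two, Matrix.tail_cons, Matrix.head_cons, Units.val_inv_eq_inv_val, Units.val_mk0]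
  have hsu : ((s : ↥(unitaryGroupOfForm (galAdicCompletionMap (L := L) (IsCMField.complexConj L) hw) ((StdForm.antidiagonal 3).over (w.1.adicCompletion L)))) :
      GL (Fin 3) (w.1.adicCompletion L)) = glDiagonal 3 (w.1.adicCompletion L) u := by
    refine Units.ext ?_
    rw [hs, coe_glDiagonal]
    ext i j
    fin_cases i <;> fin_cases j <;> simp [hu0, hu1, hu2, Matrix.diagonal]
  have hu : ∀ i j : Fin 3, i < j → valuation (w.1.adicCompletion L) ((u i : w.1.adicCompletion L) * ((u j : w.1.adicCompletion L))⁻¹) ≤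
      valuation (w.1.adicCompletion L) ϖ := by
    intro i j hij
    fin_cases i <;> fin_cases j
    all_goals first | exact absurd hij (by decide) | skip
    · show valuation _ (((u 0 : (w.1.adicCompletion L)ˣ) : w.1.adicCompletion L) * (((u 1 : (w.1.adicCompletion L)ˣ) : w.1.adicCompletion L))⁻¹) ≤ _
      rw [hu0, hu1, inv_one, mul_one]
    · show valuation _ (((u 0 : (w.1.adicCompletion L)ˣ) : w.1.adicCompletion L) * (((u 2 : (w.1.adicCompletion L)ˣ) : w.1.adicCompletion L))⁻¹) ≤ _
      rw [hu0, hu2, inv_inv, map_mul, hvσϖ]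
      calc valuation _ ϖ * valuation _ ϖ ≤ valuation _ ϖ * 1 := mul_le_mul' le_rfl hq1.le
        _ = valuation _ ϖ := mul_one _
    · show valuation _ (((u 1 : (w.1.adicCompletion L)ˣ) : w.1.adicCompletion L) * (((u 2 : (w.1.adicCompletion L)ˣ) : w.1.adicCompletion L))⁻¹) ≤ _
      rw [hu1, hu2, inv_inv, one_mul, hvσϖ]
  -- the model datum at level `I`, with its `N̄` clause
  obtain ⟨𝓘', -, hNbar', hK0', -⟩ := K2E3IwahoriLevelDatumPF.exists_iwahoriDatum_iwahoriLevel L v w hw hϖ g₁ hg₁ hq0 hq1 s u hsu hu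
  -- the transport clauses
  have hM : ((borelTriple (galAdicCompletionMap (L := L) (IsCMField.complexConj L) hw) ((StdForm.antidiagonal 3).over (w.1.adicCompletion L)) rfl).M).comap
      (eA : Gqs L v →* ↥(unitaryGroupOfForm (galAdicCompletionMap (L := L) (IsCMField.complexConj L) hw) ((StdForm.antidiagonal 3).over (w.1.adicCompletion L)))) =
      (cmBorelTriple L 3 v).M := by
    ext g
    rw [Subgroup.mem_comap, borelTriple_M]
    exact K2E3IwahoriDetection.eA_mem_torusU_iff L v w hw eA heA g
  have hN : ((borelTriple (galAdicCompletionMap (L := L) (IsCMField.complexConj L) hw) ((StdForm.antidiagonal 3).over (w.1.adicCompletion L)) rfl).N).comap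
      (eA : Gqs L v →* ↥(unitaryGroupOfForm (galAdicCompletionMap (L := L) (IsCMField.complexConj L) hw) ((StdForm.antidiagonal 3).over (w.1.adicCompletion L)))) =
      (cmBorelTriple L 3 v).N := by
    ext g
    rw [Subgroup.mem_comap, borelTriple_N]
    exact K2E3IwahoriDetection.eA_mem_unipotentU_iff L v w hw eA heA g
  obtain ⟨𝓘, hNbar, -, hK⟩ := StructureTransport.exists_iwahoriDatum_comap eA (cmBorelTriple L 3 v)
    (borelTriple (galAdicCompletionMap (L := L) (IsCMField.complexConj L) hw) ((StdForm.antidiagonal 3).over (w.1.adicCompletion L)) rfl) hM hN 𝓘'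
  refine ⟨𝓘, ?_, ?_⟩
  · rw [hK 0, hK0', hI, hK0, hK1, ← Subgroup.comap_inf]
    rfl
  · rw [hNbar, hNbar']

/-! ## §2 `θ` on `eA⁻¹(N̄_w)` and on `P ∩ I` -/

open Classical in
include hw heA in
/-- **`θ(c) = 1` for `eA c ∈ N̄_w = N_w.map (conj w)`** (`c₀₀ = 1` at the one place `w`, ★ Z2A-3a `coe_apply_zero_zero_eq_one_of_mem_map`) — letter `hθC` of ★ V2b for the datum's
`N̄ = eA⁻¹(N̄_w)` (§1). [cite: MoyPrasad1996, §3] [cite: BruhatTits1972, (4.4.4)] -/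
theorem theta_eq_one_of_map_mem (χ₁ : (LocalRing L v)ˣ →* ℂˣ) {c : Gqs L v}
    (hc : eA c ∈ ((borelTriple (galAdicCompletionMap (L := L) (IsCMField.complexConj L) hw) ((StdForm.antidiagonal 3).over (w.1.adicCompletion L)) rfl).N).map
      (MulAut.conj (weylLongU (galAdicCompletionMap (L := L) (IsCMField.complexConj L) hw)
        (rfl : (StdForm.antidiagonal 3).over (w.1.adicCompletion L) = _))).toMonoidHom) :
    (if h : IsUnit (((c.val : GL (Fin 3) (LocalRing L v)) : Matrix (Fin 3) (Fin 3) (LocalRing L v)) 0 0) then ((χ₁ h.unit : ℂˣ) : ℂ) else 0) = 1 := by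
  have h00 : ((c.val : GL (Fin 3) (LocalRing L v)) : Matrix (Fin 3) (Fin 3) (LocalRing L v)) 0 0 = 1 := by
    rw [LocalRing.eq_iff_apply_eq (IsCMField.complexConj L) (IsCMField.complexConj_ne_one L) w hw, ← coe_eA_apply L v w hw eA heA c 0 0, Pi.one_apply]
    exact K2E3LowerUnipotentBorelIwahori.coe_apply_zero_zero_eq_one_of_mem_map _ rfl
      (galAdicCompletionMap_galAdicCompletionMap_of_smul_eq (IsCMField.complexConj L) w (IsCMField.complexConj_ne_one L) hw) hc
  have h1 : IsUnit (((c.val : GL (Fin 3) (LocalRing L v)) : Matrix (Fin 3) (Fin 3) (LocalRing L v)) 0 0) := by rw [h00]; exact isUnit_one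
  have hu : h1.unit = 1 := Units.ext (by rw [IsUnit.unit_spec, h00, Units.val_one])
  rw [dif_pos h1, hu, map_one, Units.val_one]

open Classical in
include heA hϖ hg₁ hK0 hK1 hI in
set_option maxHeartbeats 1600000 in
-- the inducing representation of `cmPrincipalSeries` read at a point of two definitionally equal carriers (class of ★ Z2A-3c (ii) §3)
/-- **Letter `hθH` of ★ V2b: `θ(p) = τ(p)·1` for `p ∈ P ∩ I`**, `τ = ((1 ⊗ (χ₁, 1)) ∘ proj) ⊗ δ^{1∕2}`: `τ(p)·1 = δ^{1∕2}(p)·χ₁(torusEntry 0 (proj p))` (★ `twist_comp_proj_apply_one`,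
★ `torusCharPair_apply`), `δ^{1∕2}(p) = 1` (`p ∈ I ⊆ K₀` compact, ★ `rootDeltaChar_eq_one_of_mem_of_isClosed_of_isCompact`), and `χ₁(torusEntry 0 (proj p)) = θ(p)` (★ Z2A-3b
`theta_eq_chi_torusEntry_proj`, `p₀₀` a unit by ★ `isUnit_apply_zero_zero_of_mem`). [cite: Rogawski1990, §12.1 p. 171] [cite: MoyPrasad1996, §3] -/
theorem theta_eq_tau_of_mem (χ₁ : (LocalRing L v)ˣ →* ℂˣ) (p : Gqs L v) (hpP : (p : ↥(unitaryGroupOfForm (conjLocal L (IsCMField.complexConj L) v) (cmLocalForm L 3 v))) ∈ (cmBorelTriple L 3 v).P) (hpI : p ∈ I) :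
    (if h : IsUnit (((p.val : GL (Fin 3) (LocalRing L v)) : Matrix (Fin 3) (Fin 3) (LocalRing L v)) 0 0) then ((χ₁ h.unit : ℂˣ) : ℂ) else 0) =
      (haveI := locallyCompactSpace_cmBorelU L 3 v
       (Representation.twist
          (((Representation.trivial ℂ ↥(torusU (conjLocal L (IsCMField.complexConj L) v) (cmLocalForm L 3 v)) ℂ).twist
            (cmTorusCharPair L v χ₁ 1)).comp (cmBorelTriple L 3 v).proj) (rootDeltaChar (cmBorelTriple L 3 v).P))
        ⟨(p : ↥(unitaryGroupOfForm (conjLocal L (IsCMField.complexConj L) v) (cmLocalForm L 3 v))), hpP⟩ 1) := by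
  haveI := locallyCompactSpace_cmBorelU L 3 v
  have hJ : cmLocalForm L 3 v = (StdForm.antidiagonal 3).over (LocalRing L v) := cmLocalForm_eq_over L 3 v
  rw [twist_comp_proj_apply_one (cmBorelTriple L 3 v) (cmTorusCharPair L v χ₁ 1) (rootDeltaChar (cmBorelTriple L 3 v).P) ⟨_, hpP⟩]
  have hlev := F0P3cStCharTSStLevelsTransport.isOpen_isCompact_levels L v w hw eA g₁ K0 K1 I hK0 hK1 hI
  have hpK : p ∈ K0 := by rw [hI] at hpI; exact (Subgroup.mem_inf.1 hpI).1
  have hδ : rootDeltaChar (cmBorelTriple L 3 v).P ⟨_, hpP⟩ = 1 :=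
    rootDeltaChar_eq_one_of_mem_of_isClosed_of_isCompact (cmBorelTriple L 3 v).P
      (isClosed_borelU (conjLocal L (IsCMField.complexConj L) v) (cmLocalForm L 3 v)) (K := K0) hlev.1.2 hpK
  rw [hδ, Units.val_one, one_mul,
    show cmTorusCharPair L v χ₁ 1 = torusCharPair (conjLocal L (IsCMField.complexConj L) v) (cmLocalForm L 3 v) hJ 0 χ₁ 1 from rfl,
    torusCharPair_apply, MonoidHom.one_apply, mul_one]
  have hunit := isUnit_apply_zero_zero_of_mem L v w hw eA heA hϖ g₁ hg₁ K0 K1 I hK0 hK1 hI hpI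
  exact theta_eq_chi_torusEntry_proj L v χ₁ ⟨_, hpP⟩ hunit

/-! ## §3 The letter `hBC`: `I ⊆ (I ∩ P)·(I ∩ N̄)` from the Iwahori factorisation of the datum -/

/-- **`b = p·c` with `p ∈ P ∩ K₀(𝓘)`, `c ∈ K₀(𝓘) ∩ N̄(𝓘)` for every `b ∈ K₀(𝓘)`** — from the datum's Iwahori factorisation `K = (K ∩ N̄)(K ∩ M)(K ∩ N)` applied to `b⁻¹`
(`b⁻¹ = x m n` ⟹ `b = (n⁻¹m⁻¹)·x⁻¹`).  Generic in a parabolic triple with an Iwahori datum. [cite: Casselman1995, Prop. 1.4.4] [cite: BruhatTits1972, (4.4.4)] -/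
theorem exists_mem_P_mul_of_mem {G : Type*} [Group G] [TopologicalSpace G] (t : ParabolicTriple G) (𝓘 : t.IwahoriDatum) (n : ℕ)
    {b : G} (hb : b ∈ 𝓘.K n) :
    ∃ p ∈ 𝓘.K n, p ∈ t.P ∧ ∃ c ∈ 𝓘.K n ⊓ 𝓘.Nbar, b = p * c := by
  have hb' : b⁻¹ ∈ (𝓘.K n : Set G) := Subgroup.inv_mem _ hb
  rw [𝓘.factorization n] at hb'
  obtain ⟨_, ⟨x, hx, m, hm, rfl⟩, k, hk, e⟩ := hb'
  have hxK := (Subgroup.mem_inf.1 hx).1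
  have hmK := (Subgroup.mem_inf.1 hm).1
  have hmM := (Subgroup.mem_inf.1 hm).2
  have hkK := (Subgroup.mem_inf.1 hk).1
  have hkN := (Subgroup.mem_inf.1 hk).2
  refine ⟨k⁻¹ * m⁻¹, Subgroup.mul_mem _ (Subgroup.inv_mem _ hkK) (Subgroup.inv_mem _ hmK),
    Subgroup.mul_mem _ (Subgroup.inv_mem _ (t.N_le hkN)) (Subgroup.inv_mem _ (t.M_le hmM)), x⁻¹, Subgroup.inv_mem _ hx, ?_⟩
  have e' : x * m * k = b⁻¹ := e
  rw [← inv_inv b, ← e', mul_inv_rev, mul_inv_rev, mul_assoc]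

end Summit.HodgeConjecture.HodgeConjecture.Cruxes.H413.K2E3BranchATypeLettersCM

end
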